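import Mathlib

/-!
# `NoHeavyLowerTail` (stmt-CriticalPhenomena-4575) — the chord gap of `p ↦ E₃` along one coordinate in closed form:
# influences on pairwise intersections versus products of influences

Support file of the `|A| = 5` / master-family surge, seat `prim-l12-p5`, `--supports stmt-CriticalPhenomena-4575`.  Pure `ring`
identities (companion of `…SahiE3TwoLevel`, whose fourteen two-level moments and Bernstein coefficients are used verbatim, and
of `…SahiChordSuperlinear`, whose conjecture `ChordSuperlinear` (FBP) they make explicit); no definitions, no named facts.

SETTING (as in `…SahiE3TwoLevel`): along one coordinate of weight `p`, the seven moments of a triple `(f,g,h)` are affine in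
`p` between their section values, `e = E[fgh]`, `aᵢ = E[fᵢ]`, `b₁ = E[gh]`, `b₂ = E[fh]`, `b₃ = E[fg]` at levels `0/1`, and
`E₃(p) = β₀(1−p)³ + 3β₁p(1−p)² + 3β₂p²(1−p) + β₃p³`.  Put `δᵢ = aᵢ¹ − aᵢ⁰` (influence of the coordinate on event `i`) and
`εᵢ = bᵢ¹ − bᵢ⁰` (influence on the INTERSECTION of the other two).  Then (this file):

* `chordGap_lower` : `3β₁ − 2β₀ − β₃ = Σᵢ δᵢεᵢ − (δ₂δ₃a₁⁰ + δ₁δ₃a₂⁰ + δ₁δ₂a₃⁰) − δ₁δ₂δ₃`,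
* `chordGap_upper` : `3β₂ − β₀ − 2β₃ = Σᵢ δᵢεᵢ − (δ₂δ₃a₁⁰ + δ₁δ₃a₂⁰ + δ₁δ₂a₃⁰) − 2δ₁δ₂δ₃`,
* `sahiE3_sub_chord` : `E₃(p) − [(1−p)β₀ + pβ₃] = p(1−p)·[Σᵢ δᵢεᵢ − (δ₂δ₃a₁⁰ + δ₁δ₃a₂⁰ + δ₁δ₂a₃⁰) − (1+p)δ₁δ₂δ₃]`.

So the triple moments `e⁰, e¹` CANCEL: chord superlinearity of `E₃` along a coordinate at weight `p` (FBP, the hypothesis of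
`SahiChordSuperlinear.sahiPositive_three_of_chordSuperlinear`) is the PAIRWISE statement
  `Σᵢ δᵢ εᵢ ≥ δ₂δ₃a₁⁰ + δ₁δ₃a₂⁰ + δ₁δ₂a₃⁰ + (1+p)·δ₁δ₂δ₃`,
and its `p`-uniform form ("S1": above the chord for every `p ∈ [0,1]`) is the same with `2` in place of `1+p`.  For up-sets
`δᵢ, εᵢ ≥ 0` are pivotality probabilities; if pivotal sets were independent of the other sections the left side would be
`2Σ_cyc δδa⁰ + 3δ₁δ₂δ₃`, so FBP can only fail through negative correlation between the pivotal set of one event and the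
sections of the others — summed over the three events and minimised over coordinates.  Census of "∃ coordinate with S1":
0 failures on all 9 240 (triple, q) of `{0,1}³`, 9 000 sampled on `{0,1}⁴`, 160 weighted graphs (P5-REPORT §3d–e).
[cite: Sahi2008, Conj. 5]; [cite: LiebSahi2021, Def. 3.1].
-/

namespace Summit.CriticalPhenomena.PercolationContinuityZ3.Theorems

namespace SahiChordGap

/-- **Lower chord gap** `3β₁ − 2β₀ − β₃` in closed form (the triple moments cancel). [this file] -/
theorem chordGap_lower {R : Type*} [CommRing R]
    (e₀ e₁ a₁₀ a₁₁ a₂₀ a₂₁ a₃₀ a₃₁ b₁₀ b₁₁ b₂₀ b₂₁ b₃₀ b₃₁ : R) :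
    let β₀ := 2 * e₀ - (a₁₀ * b₁₀ + a₂₀ * b₂₀ + a₃₀ * b₃₀) + a₁₀ * a₂₀ * a₃₀
    let β₃ := 2 * e₁ - (a₁₁ * b₁₁ + a₂₁ * b₂₁ + a₃₁ * b₃₁) + a₁₁ * a₂₁ * a₃₁
    let β₁3 := 4 * e₀ + 2 * e₁
        - ((a₁₀ * b₁₀ + a₁₀ * b₁₁ + a₁₁ * b₁₀) + (a₂₀ * b₂₀ + a₂₀ * b₂₁ + a₂₁ * b₂₀)
            + (a₃₀ * b₃₀ + a₃₀ * b₃₁ + a₃₁ * b₃₀))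
        + (a₁₁ * a₂₀ * a₃₀ + a₁₀ * a₂₁ * a₃₀ + a₁₀ * a₂₀ * a₃₁)
    β₁3 - 2 * β₀ - β₃ =
      ((a₁₁ - a₁₀) * (b₁₁ - b₁₀) + (a₂₁ - a₂₀) * (b₂₁ - b₂₀) + (a₃₁ - a₃₀) * (b₃₁ - b₃₀))
        - ((a₂₁ - a₂₀) * (a₃₁ - a₃₀) * a₁₀ + (a₁₁ - a₁₀) * (a₃₁ - a₃₀) * a₂₀
            + (a₁₁ - a₁₀) * (a₂₁ - a₂₀) * a₃₀)
        - (a₁₁ - a₁₀) * (a₂₁ - a₂₀) * (a₃₁ - a₃₀) := by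
  intro β₀ β₃ β₁3
  simp only [β₀, β₃, β₁3]
  ring

/-- **Upper chord gap** `3β₂ − β₀ − 2β₃` in closed form (one more `δ₁δ₂δ₃`). [this file] -/
theorem chordGap_upper {R : Type*} [CommRing R]
    (e₀ e₁ a₁₀ a₁₁ a₂₀ a₂₁ a₃₀ a₃₁ b₁₀ b₁₁ b₂₀ b₂₁ b₃₀ b₃₁ : R) :
    let β₀ := 2 * e₀ - (a₁₀ * b₁₀ + a₂₀ * b₂₀ + a₃₀ * b₃₀) + a₁₀ * a₂₀ * a₃₀
    let β₃ := 2 * e₁ - (a₁₁ * b₁₁ + a₂₁ * b₂₁ + a₃₁ * b₃₁) + a₁₁ * a₂₁ * a₃₁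
    let β₂3 := 4 * e₁ + 2 * e₀
        - ((a₁₁ * b₁₁ + a₁₁ * b₁₀ + a₁₀ * b₁₁) + (a₂₁ * b₂₁ + a₂₁ * b₂₀ + a₂₀ * b₂₁)
            + (a₃₁ * b₃₁ + a₃₁ * b₃₀ + a₃₀ * b₃₁))
        + (a₁₀ * a₂₁ * a₃₁ + a₁₁ * a₂₀ * a₃₁ + a₁₁ * a₂₁ * a₃₀)
    β₂3 - β₀ - 2 * β₃ =
      ((a₁₁ - a₁₀) * (b₁₁ - b₁₀) + (a₂₁ - a₂₀) * (b₂₁ - b₂₀) + (a₃₁ - a₃₀) * (b₃₁ - b₃₀))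
        - ((a₂₁ - a₂₀) * (a₃₁ - a₃₀) * a₁₀ + (a₁₁ - a₁₀) * (a₃₁ - a₃₀) * a₂₀
            + (a₁₁ - a₁₀) * (a₂₁ - a₂₀) * a₃₀)
        - 2 * ((a₁₁ - a₁₀) * (a₂₁ - a₂₀) * (a₃₁ - a₃₀)) := by
  intro β₀ β₃ β₂3
  simp only [β₀, β₃, β₂3]
  ring

/-- **`E₃` minus its chord along one coordinate**, at weight `p`:
`E₃(p) − [(1−p)E₃(0) + pE₃(1)] = p(1−p)·[Σᵢδᵢεᵢ − Σ_cyc δₖδₗaᵢ⁰ − (1+p)δ₁δ₂δ₃]` — the FBP margin of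
`…SahiChordSuperlinear` in closed form; nonnegativity for SOME coordinate of every monotone indicator triple is the census
target `ChordSuperlinear`. [this file] -/
theorem sahiE3_sub_chord {R : Type*} [CommRing R]
    (e₀ e₁ a₁₀ a₁₁ a₂₀ a₂₁ a₃₀ a₃₁ b₁₀ b₁₁ b₂₀ b₂₁ b₃₀ b₃₁ p : R) :
    let E3 : R → R := fun p =>
      2 * ((1 - p) * e₀ + p * e₁)
        - (((1 - p) * a₁₀ + p * a₁₁) * ((1 - p) * b₁₀ + p * b₁₁)
          + ((1 - p) * a₂₀ + p * a₂₁) * ((1 - p) * b₂₀ + p * b₂₁)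
          + ((1 - p) * a₃₀ + p * a₃₁) * ((1 - p) * b₃₀ + p * b₃₁))
        + ((1 - p) * a₁₀ + p * a₁₁) * ((1 - p) * a₂₀ + p * a₂₁) * ((1 - p) * a₃₀ + p * a₃₁)
    E3 p - ((1 - p) * E3 0 + p * E3 1) =
      p * (1 - p) *
        (((a₁₁ - a₁₀) * (b₁₁ - b₁₀) + (a₂₁ - a₂₀) * (b₂₁ - b₂₀) + (a₃₁ - a₃₀) * (b₃₁ - b₃₀))
          - ((a₂₁ - a₂₀) * (a₃₁ - a₃₀) * a₁₀ + (a₁₁ - a₁₀) * (a₃₁ - a₃₀) * a₂₀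
              + (a₁₁ - a₁₀) * (a₂₁ - a₂₀) * a₃₀)
          - (1 + p) * ((a₁₁ - a₁₀) * (a₂₁ - a₂₀) * (a₃₁ - a₃₀))) := by
  intro E3
  simp only [E3]
  ring

/-- **Sufficient pairwise condition.**  If along the coordinate the "independent-pivotality" lower bounds hold —
`εᵢ ≥ δₖ aₗ¹ + δₗ aₖ⁰`-type bounds are NOT assumed; instead we record the exact criterion: for `0 ≤ p ≤ 1` and
`δ₁δ₂δ₃ ≥ 0`, the `p`-uniform inequality `Σδᵢεᵢ ≥ Σ_cyc δₖδₗaᵢ⁰ + 2δ₁δ₂δ₃` ("S1") implies the FBP margin is `≥ 0` at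
every `p ∈ [0,1]`. [this file] -/
theorem fbp_of_S1 (δ₁ δ₂ δ₃ ε₁ ε₂ ε₃ a₁₀ a₂₀ a₃₀ p : ℝ) (hp0 : 0 ≤ p) (hp1 : p ≤ 1)
    (hδ : 0 ≤ δ₁ * δ₂ * δ₃)
    (hS1 : δ₂ * δ₃ * a₁₀ + δ₁ * δ₃ * a₂₀ + δ₁ * δ₂ * a₃₀ + 2 * (δ₁ * δ₂ * δ₃) ≤ δ₁ * ε₁ + δ₂ * ε₂ + δ₃ * ε₃) :
    0 ≤ p * (1 - p) *
        ((δ₁ * ε₁ + δ₂ * ε₂ + δ₃ * ε₃) - (δ₂ * δ₃ * a₁₀ + δ₁ * δ₃ * a₂₀ + δ₁ * δ₂ * a₃₀)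
          - (1 + p) * (δ₁ * δ₂ * δ₃)) := by
  apply mul_nonneg (mul_nonneg hp0 (by linarith))
  nlinarith [hδ, hS1, hp1]

/-! ### Refinement instability of the per-coordinate chord gap (appended 2026-08-20)

If the three events depend on two coins `x, x′` (weights `q, r`) only through the module variable `P = x ∨ x′` (weight
`Q = q + r − qr`), and `Δᵢ, Εᵢ, Aᵢ` are the influence of `P` on event `i`, the influence of `P` on the intersection of the other two,
and `P(event i | P = 0)`, then along the COIN `x` the data of `sahiE3_sub_chord` are `δᵢ = (1−r)Δᵢ`, `εᵢ = (1−r)Εᵢ` (the coin matters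
only when its twin is closed) and `aᵢ⁰ = Aᵢ + rΔᵢ` (given `x = 0`, `P = x′`).  The bracket of the coin is then the module bracket
MINUS `r·Δ₁Δ₂Δ₃`, scaled by `(1−r)²` (`coinBracket_eq_moduleBracket`).  Hence splitting a chord-superlinear module variable into
parallel coins with `r·Δ₁Δ₂Δ₃ >` (module bracket) makes EVERY coin violate chord superlinearity: this is exactly the mechanism of the
`k = 6` refutation `SahiChordSuperlinear.not_chordSuperlinear_five` (doubled star-α triple; module bracket `1254528/3¹⁸`,
`rΠΔ = 2488320/3¹⁸`), and the reason the surviving conjecture is stated on subsets/modules (`SahiSubsetChord.SubsetChordSuperlinear`). -/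

/-- **Coin bracket versus module bracket** (pure algebra behind the refinement instability): with `δᵢ = (1−r)Δᵢ`, `εᵢ = (1−r)Εᵢ`,
`aᵢ⁰ = Aᵢ + rΔᵢ` and module weight `Q = q + r − qr`,
`Σδᵢεᵢ − Σ_cyc δₖδₗaᵢ⁰ − (1+q)δ₁δ₂δ₃ = (1−r)²·[(ΣΔᵢΕᵢ − Σ_cyc ΔₖΔₗAᵢ − (1+Q)Δ₁Δ₂Δ₃) − r·Δ₁Δ₂Δ₃]`. [this file] -/
theorem coinBracket_eq_moduleBracket {R : Type*} [CommRing R] (Δ₁ Δ₂ Δ₃ Ε₁ Ε₂ Ε₃ A₁ A₂ A₃ q r : R) :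
    ((1 - r) * Δ₁) * ((1 - r) * Ε₁) + ((1 - r) * Δ₂) * ((1 - r) * Ε₂) + ((1 - r) * Δ₃) * ((1 - r) * Ε₃)
      - (((1 - r) * Δ₂) * ((1 - r) * Δ₃) * (A₁ + r * Δ₁) + ((1 - r) * Δ₁) * ((1 - r) * Δ₃) * (A₂ + r * Δ₂)
          + ((1 - r) * Δ₁) * ((1 - r) * Δ₂) * (A₃ + r * Δ₃))
      - (1 + q) * (((1 - r) * Δ₁) * ((1 - r) * Δ₂) * ((1 - r) * Δ₃)) =
    (1 - r) ^ 2 *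
      ((Δ₁ * Ε₁ + Δ₂ * Ε₂ + Δ₃ * Ε₃ - (Δ₂ * Δ₃ * A₁ + Δ₁ * Δ₃ * A₂ + Δ₁ * Δ₂ * A₃)
          - (1 + (q + r - q * r)) * (Δ₁ * Δ₂ * Δ₃)) - r * (Δ₁ * Δ₂ * Δ₃)) := by
  ring

end SahiChordGap

end Summit.CriticalPhenomena.PercolationContinuityZ3.Theorems
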